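import Summits.QuantumFields.YangMills.Theorems.BalabanLadderIRcofEquipartitionSeamSpectralDictJoint
import HarnessLib

/-!
# Crux `IRcof` (stmt-QuantumFields-26930) · line `equipartition_seam` (row 47) · stub D `KernelCurrency.SpectralDictV` — SPECTRAL DICTIONARY,
# PART 2∕5 — §4 the WEIGHTLESS twisted trace formula `Σᵢ χᵢ(c) λᵢ^{M+2} = ∫ (κ^{[M+1]} K(·,x))(T_c x) dμ`, §5 the growth rate of the traces is the top eigenvalue

SOURCE OF RECORD: `Cruxes/IRcof/Lines/equipartition_seam_SpectralDict.lean` (crux write 2e444f4e44a5, 1436 l.; author ideator ym-ir-idea-22 g7; critic ym-ir-crit-3 g5 TYPEREAD CLEAN + JUNK ∕ COSTUME ∕ SHRED PASS, bus l.≈1712, landing conditions L1–L4) — split VERBATIM along its §§ into ≤ 400-line Theorems files by LEAD prover ym-ir-line-ab-p1 g8 (LAND-ASK of idea-22 g7). §0 of the source (a verbatim copy of `Literature/Analysis/OperatorTheory/HermitianKernelSandwichedTrace.lean`) is NOT landed (condition L2): the part that needs it imports the Literature module by name.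

HONEST FRAMING.  Abstract operator theory on `L²(X, μ; ℂ)` (Koopman unitaries, joint eigenbasis, trace formulas, kernel calculus); nothing located on the lattice is proved by this file (stubs S1, S3ʷ, T, N, S5ᵛ of row 47 open; D is re-located onto the lattice stub L `SliceRealisationV` in the last part); row 47 class PWP, mechanism 0, width 0; `IRcof` ∕ `IR` 0∕1; the Yang–Mills mass gap (Clay) is NOT proved by anything in this tree; R4 closes only the conditional finite-𝕋⁴ rung `BalabanLadder.UV`.
-/

noncomputable section

open MeasureTheory Filter Function Topology
open scoped InnerProductSpace ComplexConjugate ENNReal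
open Literature.Analysis.OperatorTheory

namespace Summit.QuantumFields.YangMills.Cruxes.IRcof.EquipartitionSeam.SpectralDict

variable {X : Type*} [MeasurableSpace X] {μ : Measure X}

/-! ## §4 The weightless twisted trace formula `Σᵢ χᵢ(c) λᵢ^{M+2} = ∫ (κ^{[M+1]} K(·, x))(T_c x) dμ(x)`

Complex port of the tree's REAL `hasSum_pow_integral_iterate_twisted` (`TwistedKernelTraceFormula.lean`) on the
template of `hasSum_pow_integral_obs_iterate_diag_rclike`: for a measure-preserving `T` acting on the joint eigenbasis by
`U_T bᵢ = χᵢ bᵢ` wherever `λᵢ ≠ 0`, the twisted coefficient `∫ (κbᵢ)(T x) conj((κbᵢ)(x)) dμ = λᵢ² ⟪bᵢ, U_T bᵢ⟫ = λᵢ² χᵢ`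
carries the factor `λᵢ²`, so the kernel of `A` (where no character is defined) drops out by itself. -/

section Trace

variable [IsFiniteMeasure μ] {K : X → X → ℂ} {C : ℝ} {A : Lp ℂ 2 μ →L[ℂ] Lp ℂ 2 μ} {ι : Type*}
  {b : HilbertBasis ι ℂ (Lp ℂ 2 μ)} {lam : ι → ℝ}

omit [IsFiniteMeasure μ] in
/-- The twisted coefficient: `∫ (κbᵢ)(T x) · conj (κbᵢ)(x) dμ(x) = λᵢ² ⟪bᵢ, U_T bᵢ⟫`. -/
theorem integral_twisted_coeff_eq (hA : ∀ φ : Lp ℂ 2 μ, (A φ : X → ℂ) =ᵐ[μ] fun x => ∫ y, K x y * φ y ∂μ)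
    (hb : ∀ i, A (b i) = (lam i : ℂ) • b i) {T : X → X} (hT : MeasurePreserving T μ μ) (i : ι) :
    ∫ x, (∫ z, K (T x) z * b i z ∂μ) * conj (∫ z, K x z * b i z ∂μ) ∂μ =
      (lam i : ℂ) ^ 2 * ⟪(b i : Lp ℂ 2 μ), koop T hT (b i)⟫_ℂ := by
  have h1 := integral_kernel_mul_basis_ae_eq hA hb i
  have h2 : (fun x => ∫ z, K (T x) z * b i z ∂μ) =ᵐ[μ] fun x => (lam i : ℂ) * b i (T x) := ae_eq_comp_mp hT h1
  have h3 : ⟪(b i : Lp ℂ 2 μ), koop T hT (b i)⟫_ℂ = ∫ x, conj ((b i : Lp ℂ 2 μ) x) * (b i : Lp ℂ 2 μ) (T x) ∂μ := by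
    rw [L2.inner_def]
    refine integral_congr_ae ?_
    filter_upwards [coeFn_koop hT (b i : Lp ℂ 2 μ)] with x hx
    rw [RCLike.inner_apply', hx]
  rw [h3, ← integral_const_mul]
  refine integral_congr_ae ?_
  filter_upwards [h1, h2] with x hx1 hx2
  rw [hx1, hx2, map_mul, Complex.conj_ofReal]
  ring

/-- **Weightless twisted trace formula.**  `Σᵢ χᵢ λᵢ^{M+2} = ∫ (κ^{[M+1]} K(·, x))(T x) dμ(x)` for a bounded Hermitian
kernel, a countable Hilbert basis of eigenvectors `A bᵢ = λᵢ bᵢ` and a measure-preserving `T` with `U_T bᵢ = χᵢ bᵢ`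
wherever `λᵢ ≠ 0`. -/
theorem hasSum_chi_pow_integral_iterate_twisted [Countable ι] (hK : StronglyMeasurable (uncurry K))
    (hC : ∀ x y, ‖K x y‖ ≤ C) (hherm : ∀ x y, K x y = conj (K y x))
    (hA : ∀ φ : Lp ℂ 2 μ, (A φ : X → ℂ) =ᵐ[μ] fun x => ∫ y, K x y * φ y ∂μ)
    (hb : ∀ i, A (b i) = (lam i : ℂ) • b i) {T : X → X} (hT : MeasurePreserving T μ μ) {χ : ι → ℂ}
    (hχ : ∀ i, lam i ≠ 0 → koop T hT (b i) = χ i • b i) (M : ℕ) :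
    HasSum (fun i => χ i * (lam i : ℂ) ^ (M + 2))
      (∫ x, ((fun f : X → ℂ => fun w => ∫ z, K w z * f z ∂μ)^[M + 1] (fun z => K z x)) (T x) ∂μ) := by
  set cf : ι → X → ℂ := fun i x => ∫ z, K x z * b i z ∂μ with hcf
  set F : ι → X → ℂ := fun i x => (lam i : ℂ) ^ M * (cf i (T x) * conj (cf i x)) with hF
  set bd : ι → X → ℝ := fun i x => ‖A‖ ^ M * ((‖cf i (T x)‖ ^ 2 + ‖cf i x‖ ^ 2) / 2) with hbd
  have hTm : Measurable T := hT.measurable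
  have hcfm : ∀ i, Measurable (cf i) := fun i => (stronglyMeasurable_integral_kernel_mul hK (b i)).measurable
  have hFm : ∀ i, Measurable (F i) := fun i =>
    (((hcfm i).comp hTm).mul (RCLike.continuous_conj.measurable.comp (hcfm i))).const_mul _
  have hlamA : ∀ i, ‖(lam i : ℂ)‖ ≤ ‖A‖ := norm_eigval_le_opNorm hb
  -- (0) pointwise expansion at the pair `(T x, x)`
  have hpt : ∀ x, HasSum (fun i => F i x)
      (((fun f : X → ℂ => fun w => ∫ z, K w z * f z ∂μ)^[M + 1] (fun z => K z x)) (T x)) := fun x => by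
    rw [iterate_kernel_eq_inner_rclike hK hC hherm hA M x (T x)]
    exact hasSum_inner_conj_section_pow hK hC hherm hA hb M x (T x)
  -- (1) domination
  have hbound : ∀ i x, ‖F i x‖ ≤ bd i x := fun i x => by
    simp only [hF, hbd]
    rw [norm_mul, norm_mul, norm_pow, RCLike.norm_conj]
    have h2 : ‖(lam i : ℂ)‖ ^ M ≤ ‖A‖ ^ M := pow_le_pow_left₀ (norm_nonneg _) (hlamA i) M
    have h3 : ‖cf i (T x)‖ * ‖cf i x‖ ≤ (‖cf i (T x)‖ ^ 2 + ‖cf i x‖ ^ 2) / 2 := by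
      nlinarith [sq_nonneg (‖cf i (T x)‖ - ‖cf i x‖), norm_nonneg (cf i (T x)), norm_nonneg (cf i x)]
    exact mul_le_mul h2 h3 (by positivity) (by positivity)
  have hpars : ∀ x, Summable (fun i => ‖cf i x‖ ^ 2) ∧ ∑' i, ‖cf i x‖ ^ 2 = ∫ z, ‖K x z‖ ^ 2 ∂μ ∧
      ∫ z, ‖K x z‖ ^ 2 ∂μ ≤ C ^ 2 * μ.real Set.univ := fun x => tsum_norm_sq_integral_kernel_mul_le hK hC b x
  have hbd_sum : ∀ x, Summable fun i => bd i x := fun x =>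
    (((hpars (T x)).1.add (hpars x).1).div_const 2).mul_left _
  have hsq_meas : Measurable fun x => ∫ z, ‖K x z‖ ^ 2 ∂μ :=
    (stronglyMeasurable_integral_norm_kernel_sq hK).measurable
  have hbd_int : Integrable (fun x => ∑' i, bd i x) μ := by
    have hfun : (fun x => ∑' i, bd i x) =
        fun x => ‖A‖ ^ M * ((∫ z, ‖K (T x) z‖ ^ 2 ∂μ + ∫ z, ‖K x z‖ ^ 2 ∂μ) / 2) := by
      funext x
      simp only [hbd]
      rw [tsum_mul_left, tsum_div_const, (hpars (T x)).1.tsum_add (hpars x).1, (hpars (T x)).2.1, (hpars x).2.1]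
    rw [hfun]
    have hbdd : ∀ y, ‖∫ z, ‖K y z‖ ^ 2 ∂μ‖ ≤ C ^ 2 * μ.real Set.univ := fun y => by
      rw [Real.norm_eq_abs, abs_of_nonneg (integral_nonneg fun z => by positivity)]
      exact (hpars y).2.2
    exact (((Integrable.of_bound (hsq_meas.comp hTm).aestronglyMeasurable (C ^ 2 * μ.real Set.univ)
        (Eventually.of_forall fun x => hbdd (T x))).add
      (Integrable.of_bound hsq_meas.aestronglyMeasurable (C ^ 2 * μ.real Set.univ)
        (Eventually.of_forall fun x => hbdd x))).div_const 2).const_mul _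
  have key := hasSum_integral_of_dominated_convergence (μ := μ) bd
    (fun i => (hFm i).aestronglyMeasurable) (fun i => Eventually.of_forall (hbound i))
    (Eventually.of_forall hbd_sum) hbd_int (Eventually.of_forall hpt)
  -- (2) the terms
  have hterm : ∀ i, ∫ x, F i x ∂μ = χ i * (lam i : ℂ) ^ (M + 2) := by
    intro i
    have h1 : ∫ x, F i x ∂μ = (lam i : ℂ) ^ (M + 2) * ⟪(b i : Lp ℂ 2 μ), koop T hT (b i)⟫_ℂ := by
      simp only [hF, hcf]
      rw [integral_const_mul, integral_twisted_coeff_eq hA hb hT i, ← mul_assoc, ← pow_add]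
    rw [h1]
    by_cases h0 : lam i = 0
    · rw [h0]; simp
    · rw [hχ i h0, inner_smul_right, inner_self_eq_norm_sq_to_K, b.orthonormal.norm_eq_one i]; simp [mul_comm]
  exact key.congr_fun fun i => (hterm i).symm

end Trace

/-! ## §5 The growth rate of the traces is the top eigenvalue -/

section Growth

/-- Complex version of the tree's `exists_index_eq_norm`: an eigenvector for the eigenvalue `‖T‖` of a self-adjoint
`T` with a Hilbert basis of eigenvectors forces `‖T‖ = λᵢ` for some `i`. -/
theorem exists_index_eq_norm_complex {E : Type*} [NormedAddCommGroup E] [InnerProductSpace ℂ E] [CompleteSpace E]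
    {ι : Type*} (b : HilbertBasis ι ℂ E) {T : E →L[ℂ] E} (hT : IsSelfAdjoint T) {lam : ι → ℝ}
    (hb : ∀ i, T (b i) = (lam i : ℂ) • b i) {ψ : E} (hψ0 : ψ ≠ 0) (hψ : T ψ = ((‖T‖ : ℝ) : ℂ) • ψ) :
    ∃ i, lam i = ‖T‖ := by
  by_contra h
  push Not at h
  have hcoef : ∀ i, ⟪b i, ψ⟫_ℂ = 0 := fun i => by
    have h1 : ⟪b i, T ψ⟫_ℂ = ((‖T‖ : ℝ) : ℂ) * ⟪b i, ψ⟫_ℂ := by rw [hψ, inner_smul_right]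
    have h2 : ⟪b i, T ψ⟫_ℂ = ((lam i : ℝ) : ℂ) * ⟪b i, ψ⟫_ℂ := by
      have hs := hT.isSymmetric (b i) ψ
      simp only [ContinuousLinearMap.coe_coe] at hs
      rw [← hs, hb, inner_smul_left, Complex.conj_ofReal]
    have h3 : (((lam i : ℝ) : ℂ) - ((‖T‖ : ℝ) : ℂ)) * ⟪b i, ψ⟫_ℂ = 0 := by rw [sub_mul, ← h2, ← h1, sub_self]
    refine (mul_eq_zero.1 h3).resolve_left ?_
    intro h4
    exact h i (Complex.ofReal_inj.mp (sub_eq_zero.mp h4))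
  apply hψ0
  have hr : b.repr ψ = 0 := lp.ext (funext fun i => by simp [HilbertBasis.repr_apply_apply, hcoef i])
  exact b.repr.injective (by rw [hr, map_zero])

/-- **Growth rate = top of the spectrum.**  If `Z (n+1) = Σᵢ λᵢ^{n+2}` for all `n` where `A bᵢ = λᵢ bᵢ` is a Hilbert
eigenbasis of a compact self-adjoint `A` with `0 ≤ Re ⟪φ, Aφ⟫` and `0 ≤ λᵢ`, then
`limsup_m Z(m)^{1/(m+1)} = ‖A‖` — also when `A = 0` (then `Z (n+1) = 0`). -/
theorem limsup_rpow_eq_norm {E : Type*} [NormedAddCommGroup E] [InnerProductSpace ℂ E] [CompleteSpace E]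
    {ι : Type*} (b : HilbertBasis ι ℂ E) {A : E →L[ℂ] E} (hAsa : IsSelfAdjoint A) (hAc : IsCompactOperator A)
    (hpos : ∀ φ : E, 0 ≤ RCLike.re ⟪φ, A φ⟫_ℂ) {lam : ι → ℝ} (hb : ∀ i, A (b i) = (lam i : ℂ) • b i)
    (hlam0 : ∀ i, 0 ≤ lam i) {Z : ℕ → ℝ} (hZ : ∀ n, HasSum (fun i => lam i ^ (n + 2)) (Z (n + 1))) :
    limsup (fun m : ℕ => Z m ^ (((m : ℝ) + 1)⁻¹)) atTop = ‖A‖ := by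
  have hlamle : ∀ i, lam i ≤ ‖A‖ := fun i => by
    have h1 : ‖A (b i)‖ = ‖(lam i : ℂ)‖ := by rw [hb, norm_smul, b.orthonormal.norm_eq_one i, mul_one]
    have h2 : ‖A (b i)‖ ≤ ‖A‖ := by
      calc ‖A (b i)‖ ≤ ‖A‖ * ‖b i‖ := A.le_opNorm _
        _ = ‖A‖ := by rw [b.orthonormal.norm_eq_one i, mul_one]
    rw [h1, Complex.norm_real, Real.norm_eq_abs] at h2
    exact (le_abs_self _).trans h2
  by_cases hA0 : A = 0
  · -- all eigenvalues vanish, `Z (n+1) = 0`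
    have hl0 : ∀ i, lam i = 0 := fun i => le_antisymm (by simpa [hA0] using hlamle i) (hlam0 i)
    have hZ0 : ∀ n, Z (n + 1) = 0 := fun n => by
      have h := hZ n
      have h' : HasSum (fun _ : ι => (0 : ℝ)) (Z (n + 1)) :=
        h.congr_fun fun i => by rw [hl0 i, zero_pow (by omega)]
      exact h'.unique hasSum_zero
    have hev : (fun m : ℕ => Z m ^ (((m : ℝ) + 1)⁻¹)) =ᶠ[atTop] fun _ => (0 : ℝ) := by
      filter_upwards [Filter.eventually_ge_atTop 1] with m hm
      obtain ⟨n, rfl⟩ := Nat.exists_eq_add_of_le' hm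
      rw [hZ0 n, Real.zero_rpow (inv_ne_zero (by positivity))]
    rw [Filter.limsup_congr hev, Filter.limsup_const, hA0, norm_zero]
  · -- an eigenvector for `‖A‖` exists; it is one of the `bᵢ`
    have hnt : Nontrivial E := by
      by_contra hE
      have : Subsingleton E := not_nontrivial_iff_subsingleton.mp hE
      exact hA0 (Subsingleton.elim _ _)
    obtain ⟨Ω, hΩ1, hΩ⟩ := exists_eigenvector_norm_of_re_inner_nonneg hAsa hAc hpos
    have hΩ0 : Ω ≠ 0 := by
      intro h; rw [h, norm_zero] at hΩ1; exact zero_ne_one hΩ1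
    obtain ⟨i₀, hi₀⟩ := exists_index_eq_norm_complex b hAsa hb hΩ0 hΩ
    have hL0 : 0 < lam i₀ := by rw [hi₀]; exact norm_pos_iff.mpr hA0
    rw [← hi₀]
    exact limsup_rpow_eq_of_hasSum_pow hlam0 (fun i => (hlamle i).trans_eq hi₀.symm) hL0 (hZ 0).summable hZ

end Growth

end Summit.QuantumFields.YangMills.Cruxes.IRcof.EquipartitionSeam.SpectralDict

end
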